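import Summits.QuantumFields.BalabanUV.Beta.GAN24.DirichletRingCutoff

/-!
# `BalabanUV.Beta.GAN24.DirichletRingCutoffRing` — binder row G-an2-4 / (CONV-C), road P2 PART IV, leaf L11 (model), part 2: THE TWO-DIMENSIONAL
# RING CUT-OFF AT SCALE `L` — zero on `Q_{2L}`, one on the rings `4L ≤ ρ ≤ 10L`, zero outside `Q_{20L−1}`, with `|δχ| ≤ 2/L`, `|δ²χ| ≤ 2/L²`
# (unit b2b-balaban-gan24-p2, gen 25, v1)

HONEST FRAMING (cell contract, verbatim): «discharging `BetaPertH` makes Bałaban's UV stability UNCONDITIONAL — a real constructive-QFT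
result; it is NOT the continuum limit and NOT the Clay problem.»  Second half of leaf L11 in MODEL COORDINATES (memo
`HOME/b2b-balaban-gan24-p2/gen24/W-FULL-WEIGHTED.md` §3; plan `HOME/b2b-balaban-gan24-p2/gen25/RING-LEMMA-KERNEL.md` §6): from the 1-D profile
`eta` of `DirichletRingCutoff` the separable cut-off
`chi L (i,j) = [1 − (1 − η_L(i))(1 − η_L(j))]·[(1 − η_{5L}(i))(1 − η_{5L}(j))]`
(ring index `ρ(i,j) = max(tIdx i, tIdx j)`, so `Q_k = {ρ ≤ k}`):
 * `chi_mem` (`0 ≤ χ ≤ 1`), `chi_eq_zero_inner` (`χ = 0` on `Q_{2L}`), `chi_eq_one` (`χ = 1` if `4L ≤ ρ ≤ 10L`), `chi_eq_zero_outer` (`χ = 0` if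
   `ρ ≥ 20L`), `chi_symm`;
 * **`abs_chi_sub_le`**/**`abs_chi_dd_le`** — along either lattice direction `|δχ| ≤ 2/L` and `|δ²χ| ≤ 2/L²` (the product rules
   `DirichletRingCutoff.abs_sub_mul_le`/`abs_dd_mul_le` with `α = 1/L`, `β = 1/(5L)`).
Consumer: the Hessian window estimate (L12-model): `z = χ·U` is finitely supported, vanishes on the quadrant and at the vertex, equals `U` to second
order on the window `4L < ρ < 10L`, and `Δz − χΔU` is controlled by `DirichletRingCutoff.norm_commutator_sq_le` with these `α, β`.

ABSOLUTE RULE (cell, verbatim): «No internally-minted statement may enter as a cited fact. Every hypothesis is either kernel-proved in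
this package or a verbatim quotation of a PUBLISHED theorem with page reference. The manuscript(s) under audit are NOT citable for
their own disputed steps — they are the thing under adjudication; programme-internal (2001/route/tribunal) claims are never citable.»
[folklore] elementary; nothing printed is a hypothesis.  NOT CLAIMED: (A)/(B), NE2, (CONV-C), `BetaPertH`, continuum, Clay.  «not in print; our
proof attempt».  HONEST DEPENDENCY: continuum YM on T⁴ ⇐ BetaPertH ∧ nine spine estimates (0/9 proved); BetaPertH ⇐ (D1) ∧ (D4) ∧ CAP+tail;
G-an2-4 gates asym, D1 and NE2/3/4.
-/

noncomputable section

namespace Summit.QuantumFields.BalabanUV.Beta.GAN24.DirichletRingCutoffRing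

open DirichletRingCutoff

/-- the separable ring cut-off at scale `L` (inner transition `2L < ρ < 4L`, outer transition `10L < ρ < 20L`). [folklore] -/
def chi (L : ℕ) (i j : ℤ) : ℝ := (1 - (1 - eta L i) * (1 - eta L j)) * ((1 - eta (5 * L) i) * (1 - eta (5 * L) j))

variable {L : ℕ} (hL : 1 ≤ L)
include hL

omit hL in
/-- symmetry `χ(i,j) = χ(j,i)`. [folklore] -/
theorem chi_symm (i j : ℤ) : chi L i j = chi L j i := by unfold chi; ring

/-- `0 ≤ χ ≤ 1`. [folklore] -/
theorem chi_mem (i j : ℤ) : 0 ≤ chi L i j ∧ chi L i j ≤ 1 := by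
  have hL5 : 1 ≤ 5 * L := by omega
  obtain ⟨a0, a1⟩ := eta_mem hL i
  obtain ⟨b0, b1⟩ := eta_mem hL j
  obtain ⟨c0, c1⟩ := eta_mem hL5 i
  obtain ⟨d0, d1⟩ := eta_mem hL5 j
  unfold chi
  have h1 : 0 ≤ (1 - eta L i) * (1 - eta L j) := mul_nonneg (by linarith) (by linarith)
  have h2 : (1 - eta L i) * (1 - eta L j) ≤ 1 := by nlinarith
  have h3 : 0 ≤ (1 - eta (5 * L) i) * (1 - eta (5 * L) j) := mul_nonneg (by linarith) (by linarith)
  have h4 : (1 - eta (5 * L) i) * (1 - eta (5 * L) j) ≤ 1 := by nlinarith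
  constructor
  · exact mul_nonneg (by linarith) h3
  · nlinarith

omit hL in
/-- `χ = 0` on the inner square `Q_{2L}`. [folklore] -/
theorem chi_eq_zero_inner {i j : ℤ} (hi : tIdx i ≤ 2 * (L : ℤ)) (hj : tIdx j ≤ 2 * (L : ℤ)) : chi L i j = 0 := by
  unfold chi; rw [eta_eq_zero hi, eta_eq_zero hj]; ring

/-- `χ = 1` on the rings `4L ≤ ρ ≤ 10L`. [folklore] -/
theorem chi_eq_one {i j : ℤ} (h : 4 * (L : ℤ) ≤ tIdx i ∨ 4 * (L : ℤ) ≤ tIdx j) (hi : tIdx i ≤ 10 * (L : ℤ)) (hj : tIdx j ≤ 10 * (L : ℤ)) :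
    chi L i j = 1 := by
  have e1 : eta (5 * L) i = 0 := eta_eq_zero (by push_cast; omega)
  have e2 : eta (5 * L) j = 0 := eta_eq_zero (by push_cast; omega)
  unfold chi; rw [e1, e2]
  rcases h with h | h
  · rw [eta_eq_one hL h]; ring
  · rw [eta_eq_one hL h]; ring

/-- `χ = 0` outside `Q_{20L−1}` (i.e. where `ρ ≥ 20L`). [folklore] -/
theorem chi_eq_zero_outer {i j : ℤ} (h : 20 * (L : ℤ) ≤ tIdx i ∨ 20 * (L : ℤ) ≤ tIdx j) : chi L i j = 0 := by
  have hL5 : 1 ≤ 5 * L := by omega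
  unfold chi
  rcases h with h | h
  · rw [eta_eq_one hL5 (i := i) (by push_cast; omega)]; ring
  · rw [eta_eq_one hL5 (i := j) (by push_cast; omega)]; ring

/-- **first differences**: `|χ(i+1,j) − χ(i,j)| ≤ 2/L`. [folklore] -/
theorem abs_chi_sub_le₁ (i j : ℤ) : |chi L (i + 1) j - chi L i j| ≤ 2 / (L : ℝ) := by
  have hL0 : (0 : ℝ) < L := by exact_mod_cast hL
  have hL5 : 1 ≤ 5 * L := by omega
  obtain ⟨c0, c1⟩ := eta_mem hL j
  obtain ⟨d0, d1⟩ := eta_mem hL5 j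
  set c := 1 - eta L j with hc
  set d := 1 - eta (5 * L) j with hd
  set F : ℤ → ℝ := fun i => 1 - (1 - eta L i) * c with hF
  set G : ℤ → ℝ := fun i => (1 - eta (5 * L) i) * d with hG
  have hFG : ∀ i, chi L i j = F i * G i := fun i => by simp only [chi, hF, hG, hc, hd]
  have hf : ∀ i, |F i| ≤ 1 := fun i => by
    obtain ⟨a0, a1⟩ := eta_mem hL i
    rw [abs_le]; constructor <;> simp only [hF] <;> nlinarith
  have hg : ∀ i, |G i| ≤ 1 := fun i => by
    obtain ⟨a0, a1⟩ := eta_mem hL5 i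
    rw [abs_le]; constructor <;> simp only [hG] <;> nlinarith
  have hdf : ∀ i, |F (i + 1) - F i| ≤ 1 / (L : ℝ) := fun i => by
    have e : F (i + 1) - F i = (eta L (i + 1) - eta L i) * c := by simp only [hF]; ring
    rw [e, abs_mul, abs_of_nonneg (by linarith : 0 ≤ c)]
    calc _ ≤ 1 / (L : ℝ) * 1 := mul_le_mul (abs_eta_sub_le hL i) (by linarith) (by linarith) (by positivity)
      _ = _ := mul_one _
  have hdg : ∀ i, |G (i + 1) - G i| ≤ 1 / ((5 * L : ℕ) : ℝ) := fun i => by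
    have e : G (i + 1) - G i = -((eta (5 * L) (i + 1) - eta (5 * L) i) * d) := by simp only [hG]; ring
    rw [e, abs_neg, abs_mul, abs_of_nonneg (by linarith : 0 ≤ d)]
    calc _ ≤ 1 / ((5 * L : ℕ) : ℝ) * 1 := mul_le_mul (abs_eta_sub_le hL5 i) (by linarith) (by linarith) (by positivity)
      _ = _ := mul_one _
  rw [hFG, hFG]
  refine (abs_sub_mul_le hf hg hdf hdg i).trans ?_
  push_cast
  rw [div_add_div _ _ hL0.ne' (by positivity), div_le_div_iff₀ (by positivity) hL0]
  nlinarith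

/-- **second differences**: `|χ(i+1,j) − 2χ(i,j) + χ(i−1,j)| ≤ 2/L²`. [folklore] -/
theorem abs_chi_dd_le₁ (i j : ℤ) : |chi L (i + 1) j - 2 * chi L i j + chi L (i - 1) j| ≤ 2 / (L : ℝ) ^ 2 := by
  have hL0 : (0 : ℝ) < L := by exact_mod_cast hL
  have hL5 : 1 ≤ 5 * L := by omega
  obtain ⟨c0, c1⟩ := eta_mem hL j
  obtain ⟨d0, d1⟩ := eta_mem hL5 j
  set c := 1 - eta L j with hc
  set d := 1 - eta (5 * L) j with hd
  set F : ℤ → ℝ := fun i => 1 - (1 - eta L i) * c with hF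
  set G : ℤ → ℝ := fun i => (1 - eta (5 * L) i) * d with hG
  have hFG : ∀ i, chi L i j = F i * G i := fun i => by simp only [chi, hF, hG, hc, hd]
  have hf : ∀ i, |F i| ≤ 1 := fun i => by
    obtain ⟨a0, a1⟩ := eta_mem hL i
    rw [abs_le]; constructor <;> simp only [hF] <;> nlinarith
  have hg : ∀ i, |G i| ≤ 1 := fun i => by
    obtain ⟨a0, a1⟩ := eta_mem hL5 i
    rw [abs_le]; constructor <;> simp only [hG] <;> nlinarith
  have hdf : ∀ i, |F (i + 1) - F i| ≤ 1 / (L : ℝ) := fun i => by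
    have e : F (i + 1) - F i = (eta L (i + 1) - eta L i) * c := by simp only [hF]; ring
    rw [e, abs_mul, abs_of_nonneg (by linarith : 0 ≤ c)]
    calc _ ≤ 1 / (L : ℝ) * 1 := mul_le_mul (abs_eta_sub_le hL i) (by linarith) (by linarith) (by positivity)
      _ = _ := mul_one _
  have hdg : ∀ i, |G (i + 1) - G i| ≤ 1 / ((5 * L : ℕ) : ℝ) := fun i => by
    have e : G (i + 1) - G i = -((eta (5 * L) (i + 1) - eta (5 * L) i) * d) := by simp only [hG]; ring
    rw [e, abs_neg, abs_mul, abs_of_nonneg (by linarith : 0 ≤ d)]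
    calc _ ≤ 1 / ((5 * L : ℕ) : ℝ) * 1 := mul_le_mul (abs_eta_sub_le hL5 i) (by linarith) (by linarith) (by positivity)
      _ = _ := mul_one _
  have hddf : ∀ i, |F (i + 1) - 2 * F i + F (i - 1)| ≤ 1 / (L : ℝ) ^ 2 := fun i => by
    have e : F (i + 1) - 2 * F i + F (i - 1) = (eta L (i + 1) - 2 * eta L i + eta L (i - 1)) * c := by simp only [hF]; ring
    rw [e, abs_mul, abs_of_nonneg (by linarith : 0 ≤ c)]
    calc _ ≤ 1 / (L : ℝ) ^ 2 * 1 := mul_le_mul (abs_eta_dd_le hL i) (by linarith) (by linarith) (by positivity)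
      _ = _ := mul_one _
  have hddg : ∀ i, |G (i + 1) - 2 * G i + G (i - 1)| ≤ 1 / ((5 * L : ℕ) : ℝ) ^ 2 := fun i => by
    have e : G (i + 1) - 2 * G i + G (i - 1) = -((eta (5 * L) (i + 1) - 2 * eta (5 * L) i + eta (5 * L) (i - 1)) * d) := by
      simp only [hG]; ring
    rw [e, abs_neg, abs_mul, abs_of_nonneg (by linarith : 0 ≤ d)]
    calc _ ≤ 1 / ((5 * L : ℕ) : ℝ) ^ 2 * 1 := mul_le_mul (abs_eta_dd_le hL5 i) (by linarith) (by linarith) (by positivity)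
      _ = _ := mul_one _
  rw [hFG, hFG, hFG]
  refine (abs_dd_mul_le hf hg hdf hdg hddf hddg i).trans ?_
  push_cast
  have e : 1 / (L : ℝ) ^ 2 + 1 / (5 * (L : ℝ)) ^ 2 + 2 * (1 / (L : ℝ) * (1 / (5 * (L : ℝ)))) = (36 / 25) / (L : ℝ) ^ 2 := by
    field_simp; ring
  rw [e, div_le_div_iff₀ (by positivity) (by positivity)]
  nlinarith [hL0]

/-- first differences in the second direction. [folklore] -/
theorem abs_chi_sub_le₂ (i j : ℤ) : |chi L i (j + 1) - chi L i j| ≤ 2 / (L : ℝ) := by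
  rw [chi_symm i (j + 1), chi_symm i j]; exact abs_chi_sub_le₁ hL j i

/-- second differences in the second direction. [folklore] -/
theorem abs_chi_dd_le₂ (i j : ℤ) : |chi L i (j + 1) - 2 * chi L i j + chi L i (j - 1)| ≤ 2 / (L : ℝ) ^ 2 := by
  rw [chi_symm i (j + 1), chi_symm i j, chi_symm i (j - 1)]; exact abs_chi_dd_le₁ hL j i

/-- the backward first differences obey the same bound. [folklore] -/
theorem abs_chi_sub_le₁' (i j : ℤ) : |chi L (i - 1) j - chi L i j| ≤ 2 / (L : ℝ) := by
  rw [abs_sub_comm]; have := abs_chi_sub_le₁ hL (i - 1) j; rwa [sub_add_cancel] at this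

/-- the backward first differences in the second direction. [folklore] -/
theorem abs_chi_sub_le₂' (i j : ℤ) : |chi L i (j - 1) - chi L i j| ≤ 2 / (L : ℝ) := by
  rw [abs_sub_comm]; have := abs_chi_sub_le₂ hL i (j - 1); rwa [sub_add_cancel] at this

end Summit.QuantumFields.BalabanUV.Beta.GAN24.DirichletRingCutoffRing

end
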